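import Literature.Probability.LatticeModels.SlitPlaneKernelBounds
import HarnessLib

/-!
# The slit-plane kernel, III: the discrete Cauchy–Riemann equations of the full-plane spinor

Topic `Literature/Probability/LatticeModels`; sequel of `SlitPlaneKernel.lean` (the closed form
`K(k,s) = (1/π)∫ Re(e^{-ikt} ĝ(t)) y(t)^s dt`, `ĝ = (1 - e^{2it})^{-1/2}`, of the tip harmonic measure
of the diagonal slit) and `SlitPlaneKernelBounds.lean` (bounds, positivity, identification). Here we
prove that `K` and its mirror image assemble into Chelkak–Hongler–Izyurov's **s-holomorphic
full-plane spinor `F_{[ℂ_δ,a]}`** (Ann. of Math. 181 (2015) = arXiv:1202.2838, Lemma 2.14 and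
§3.2.2): in the coordinates `k = a + b`, `s = a - b` the corners of type `1` are the points with
`k + s` even (where `F = F¹ = ± hm_{tip}` is real, (F-1-as-hm)), those of type `i` the points with
`k + s` odd (where `F = F^i = ∓ i hm'_{source}` is imaginary and is the *mirrored* tip harmonic
measure, (3.7): pole at the source `a + δ/2 = (-1, 0)`, cut `R_a` to the right), and CHI's discrete
Cauchy–Riemann equation (3.1) on the unit square based at `(k, s)` is
`i [F(k+1,s+1) - F(k,s)] = F(k,s+1) - F(k+1,s)`.

## Main statements (all proved)

* `slitGHat_bracket_eq_zero`, `slitGHat_bracket2_eq_zero` — the two pointwise identities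
  `ĝ(e^{-it}y - 1) + ḡ e^{-it}(y - e^{-it}) = 0` and `ĝ(e^{-it} - y) + ḡ e^{-it}(e^{-it}y - 1) = 0`
  (`ḡ = conj ĝ = ĝ(1 - e^{2it})/(2|sin t|)`, no branch analysis; they reduce to
  `|sin t|(e^{-it}y - 1) = i sin t (y - e^{-it})` and to `y = ½ cos t(1 + y²)`);
* **`slitKernel_cr : K(k+1,s+1) + K(-k-1,s+1) = K(k,s) + K(-k-2,s)`** and
  **`slitKernel_cr' : K(k+1,s) + K(-k-2,s+1) = K(k,s+1) + K(-k-1,s)`** for all `k ∈ ℤ`, `s ∈ ℕ`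
  (integrate the pointwise identities);
* `slitFup`, `slitFdn : ℤ → ℤ → ℂ` — the spinor on the sheet `Ξ_+`, with the cut
  `{(k,0) : k ≤ -1 odd} ∋ source` read from above / from below: `K(k,|s|)` on the even class,
  `∓ i K(-k-1,|s|)` on the odd class; `slitFup_eq_slitFdn` (they agree off the cut),
  `slitFup_row_eq_neg` (**sign change across the cut** — the monodromy `-1`),
  `slitFup_zero_zero : F(tip) = 1`, `slitFup_neg_one_zero : F(source)⁺ = -i` (the value used in
  CHI's Lemma 3.5), `slitFup_row_eq_zero` (`F = 0` on the slit `L_a` and on `R_a`);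
* **`slitFup_cr`** (every square based at `s ≥ 0`) and **`slitFdn_cr`** (every square based at
  `s ≤ -1`): the discrete Cauchy–Riemann equations (3.1) — i.e. `F` is discrete holomorphic on the
  double cover of `ℤ²` branched at the source, CHI Lemma 2.14's "(unique) s-holomorphic spinor
  `F_{[ℂ_δ,a]}` with `F(a + 3δ/2) = 1`" in closed form (uniqueness is not needed downstream and not
  proved; `o(1)` at infinity is `abs_slitKernel_le`).

NOT here: the extension to the corners of types `λ, λ̄` and to edge midpoints (CHI Remark 3.1,
mechanical), the transport to the tree's `IsSHolomorphic`/corner frame of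
`SHolomorphicPrimitive.lean`, and the primitive `G_{[ℂ_δ,a]}` (Lemma 2.16).

## References

* D. Chelkak, C. Hongler, K. Izyurov, Ann. of Math. 181 (2015) = arXiv:1202.2838: Lemma 2.14,
  Remark 3.1 (3.1), §3.2.2 ((F-1-as-hm), (3.7), proof of Lemma 3.5) [ChelkakHonglerIzyurovAnnals2015].
-/

noncomputable section

open Complex MeasureTheory intervalIntegral Set Filter Topology Metric
open scoped Real ComplexConjugate Interval

namespace Literature.Probability.LatticeModels

/-! ### The trigonometric identity behind the discrete Cauchy–Riemann equations -/

/-- `sin² + cos² = 1` in `ℂ` for a real argument. [folklore] -/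
theorem sin_sq_add_cos_sq_ofReal (t : ℝ) : ((Real.sin t : ℝ) : ℂ) ^ 2 + ((Real.cos t : ℝ) : ℂ) ^ 2 = 1 := by
  have h := Real.sin_sq_add_cos_sq t
  exact_mod_cast h

/-- `e^{-it} = cos t - i sin t`. [folklore] -/
theorem cexp_neg_ofReal_mul_I (t : ℝ) : cexp (-((t : ℂ) * I)) = (Real.cos t : ℂ) - (Real.sin t : ℂ) * I := by
  rw [show -((t : ℂ) * I) = ((-t : ℝ) : ℂ) * I by push_cast; ring, Complex.exp_mul_I, ← ofReal_cos, ← ofReal_sin,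
    Real.cos_neg, Real.sin_neg]
  push_cast; ring

/-- **The key trigonometric identity** (cleared of denominators):
`|sin t| (e^{-it} cos t - (1 + |sin t|)) = i sin t (cos t - e^{-it}(1 + |sin t|))`, i.e. with
`y = cos t/(1 + |sin t|)`: `|sin t|(e^{-it} y - 1) = i sin t (y - e^{-it})`. [folklore] -/
theorem abs_sin_mul_key (t : ℝ) :
    ((|Real.sin t| : ℝ) : ℂ) * (cexp (-((t : ℂ) * I)) * (Real.cos t : ℂ) - (1 + ((|Real.sin t| : ℝ) : ℂ))) =
      I * (Real.sin t : ℂ) * ((Real.cos t : ℂ) - cexp (-((t : ℂ) * I)) * (1 + ((|Real.sin t| : ℝ) : ℂ))) := by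
  rw [cexp_neg_ofReal_mul_I]
  have hp := sin_sq_add_cos_sq_ofReal t
  rcases le_total 0 (Real.sin t) with h | h
  · rw [abs_of_nonneg h]
    linear_combination (-((Real.sin t : ℝ) : ℂ) ^ 2 * (1 + (Real.sin t : ℂ))) * Complex.I_sq +
      ((Real.sin t : ℝ) : ℂ) * hp
  · rw [abs_of_nonpos h, ofReal_neg]
    linear_combination (-((Real.sin t : ℝ) : ℂ) ^ 2 * (1 - (Real.sin t : ℂ))) * Complex.I_sq -
      ((Real.sin t : ℝ) : ℂ) * hp

/-- `conj ĝ = ĝ · (1 - e^{2it})/(2|sin t|)` (from `|ĝ|² = 1/(2|sin t|)` and `ĝ² = (1 - e^{2it})^{-1}`;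
no branch analysis). [folklore] -/
theorem conj_slitGHat {t : ℝ} (ht : Real.sin t ≠ 0) :
    conj (slitGHat t) = slitGHat t * circBase 1 (2 * t) / ((2 * |Real.sin t| : ℝ) : ℂ) := by
  set B := circBase 1 (2 * t) with hB
  set g := slitGHat t with hg
  have hBn : ‖B‖ = 2 * |Real.sin t| := norm_circBase_one_two_mul t
  have hs : (0 : ℝ) < 2 * |Real.sin t| := by positivity
  have hBne : B ≠ 0 := by rw [← norm_ne_zero_iff, hBn]; exact hs.ne'
  have hg2 : g ^ 2 = B⁻¹ := by
    rw [hg, slitGHat, ← hB, sq, ← cpow_add _ _ hBne, show -(1 / 2 : ℂ) + -(1 / 2 : ℂ) = -1 by norm_num,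
      cpow_neg_one]
  have hgne : g ≠ 0 := by
    intro h
    have : B⁻¹ = 0 := by rw [← hg2, h]; norm_num
    exact hBne (inv_eq_zero.1 this)
  have hn : ‖g‖ ^ 2 = (2 * |Real.sin t|)⁻¹ := by
    rw [hg, norm_slitGHat, ← Real.rpow_natCast, ← Real.rpow_mul hs.le,
      show (-(1 / 2 : ℝ) * ((2 : ℕ) : ℝ)) = -1 by norm_num, Real.rpow_neg_one]
  have hnorm : g * conj g = (((2 * |Real.sin t|)⁻¹ : ℝ) : ℂ) := by
    rw [Complex.mul_conj, Complex.normSq_eq_norm_sq, hn]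
  have hne : (((2 * |Real.sin t|) : ℝ) : ℂ) ≠ 0 := by exact_mod_cast hs.ne'
  -- `conj g = (g conj g)/g = (2|sin|)⁻¹ g⁻¹ = (2|sin|)⁻¹ g B`
  have h1 : conj g = (((2 * |Real.sin t|)⁻¹ : ℝ) : ℂ) * g⁻¹ := by
    rw [← hnorm]; field_simp
  have h2 : g⁻¹ = g * B := by
    have : g * (g * B) = 1 := by rw [← mul_assoc, ← sq, hg2, inv_mul_cancel₀ hBne]
    exact inv_eq_of_mul_eq_one_right this
  rw [h1, h2]
  push_cast
  field_simp

/-- **The bracket vanishes**: `ĝ (e^{-it} y - 1) + conj(ĝ) e^{-it} (y - e^{-it}) = 0` for every `t`. [folklore] -/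
theorem slitGHat_bracket_eq_zero (t : ℝ) :
    slitGHat t * (cexp (-((t : ℂ) * I)) * (chmY t : ℂ) - 1) +
      conj (slitGHat t) * cexp (-((t : ℂ) * I)) * ((chmY t : ℂ) - cexp (-((t : ℂ) * I))) = 0 := by
  by_cases hs : Real.sin t = 0
  · -- `ĝ(t) = 0` (junk value at the zeros of `sin`)
    have hB : circBase 1 (2 * t) = 0 := by
      rw [← norm_eq_zero, norm_circBase_one_two_mul, hs, abs_zero, mul_zero]
    have hg : slitGHat t = 0 := by rw [slitGHat, hB, zero_cpow (by norm_num)]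
    rw [hg, map_zero, zero_mul, zero_mul, zero_mul, add_zero]
  · rw [conj_slitGHat hs]
    have hne : (((2 * |Real.sin t|) : ℝ) : ℂ) ≠ 0 := by
      have : (0 : ℝ) < 2 * |Real.sin t| := by positivity
      exact_mod_cast this.ne'
    have hden : (1 : ℂ) + ((|Real.sin t| : ℝ) : ℂ) ≠ 0 := by
      have : (0 : ℝ) < 1 + |Real.sin t| := by positivity
      exact_mod_cast this.ne'
    -- `(1 - e^{2it}) e^{-it} = e^{-it} - e^{it} = -2i sin t`
    have hBe : circBase 1 (2 * t) * cexp (-((t : ℂ) * I)) = -2 * I * (Real.sin t : ℂ) := by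
      unfold circBase
      rw [ofReal_one, one_mul, sub_mul, one_mul, ← Complex.exp_add,
        show ((2 * t : ℝ) : ℂ) * I + -((t : ℂ) * I) = (t : ℂ) * I by push_cast; ring]
      rw [show -((t : ℂ) * I) = -(t : ℂ) * I by ring]
      have := Complex.two_sin (t : ℂ)
      rw [← ofReal_sin] at this
      linear_combination I * this + (cexp (-(t : ℂ) * I) - cexp ((t : ℂ) * I)) * Complex.I_sq
    -- `y (1 + |sin t|) = cos t`
    have hy : (chmY t : ℂ) * (1 + ((|Real.sin t| : ℝ) : ℂ)) = (Real.cos t : ℂ) := by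
      have h := cos_mul_chmY t
      have h2 : chmY t * (1 + |Real.sin t|) = Real.cos t := by
        rw [chmY]; field_simp
      exact_mod_cast h2
    have key := abs_sin_mul_key t
    -- the key identity, denominators restored: `|sin t|(e^{-it} y - 1) = i sin t (y - e^{-it})`
    have H0 : ((|Real.sin t| : ℝ) : ℂ) * (cexp (-((t : ℂ) * I)) * (chmY t : ℂ) - 1) =
        I * (Real.sin t : ℂ) * ((chmY t : ℂ) - cexp (-((t : ℂ) * I))) := by
      apply mul_right_cancel₀ hden
      calc ((|Real.sin t| : ℝ) : ℂ) * (cexp (-((t : ℂ) * I)) * (chmY t : ℂ) - 1) * (1 + ((|Real.sin t| : ℝ) : ℂ))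
          = ((|Real.sin t| : ℝ) : ℂ) * (cexp (-((t : ℂ) * I)) * (Real.cos t : ℂ) - (1 + ((|Real.sin t| : ℝ) : ℂ))) := by
            rw [← hy]; ring
        _ = I * (Real.sin t : ℂ) * ((Real.cos t : ℂ) - cexp (-((t : ℂ) * I)) * (1 + ((|Real.sin t| : ℝ) : ℂ))) := key
        _ = I * (Real.sin t : ℂ) * ((chmY t : ℂ) - cexp (-((t : ℂ) * I))) * (1 + ((|Real.sin t| : ℝ) : ℂ)) := by
            rw [← hy]; ring
    have hne' : ((|Real.sin t| : ℝ) : ℂ) ≠ 0 := by exact_mod_cast (abs_pos.2 hs).ne'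
    have hBe' : slitGHat t * circBase 1 (2 * t) / (((2 * |Real.sin t|) : ℝ) : ℂ) * cexp (-((t : ℂ) * I)) =
        slitGHat t * (-2 * I * (Real.sin t : ℂ)) / (((2 * |Real.sin t|) : ℝ) : ℂ) := by
      rw [div_mul_eq_mul_div, mul_assoc (slitGHat t), hBe]
    rw [hBe', show slitGHat t * (-2 * I * (Real.sin t : ℂ)) / (((2 * |Real.sin t|) : ℝ) : ℂ) *
        ((chmY t : ℂ) - cexp (-((t : ℂ) * I))) =
        -(slitGHat t * (I * (Real.sin t : ℂ) * ((chmY t : ℂ) - cexp (-((t : ℂ) * I))))) * 2 /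
          (((2 * |Real.sin t|) : ℝ) : ℂ) by ring, ← H0]
    push_cast
    field_simp
    ring



/-! ### The master identity `K(k+1,s+1) + K(-k-1,s+1) = K(k,s) + K(-k-2,s)` -/

/-- `Re(e^{imt} ĝ) = Re(e^{-imt} conj ĝ)`: the mirrored kernel integrand. [folklore] -/
theorem slitCFun_neg_int_re (m : ℤ) (t : ℝ) :
    (slitCFun (-m) t).re = (cexp (-((m : ℂ) * (t : ℂ) * I)) * conj (slitGHat t)).re := by
  rw [← Complex.conj_re (slitCFun (-m) t), slitCFun, map_mul, ← Complex.exp_conj]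
  congr 3
  simp only [map_neg, map_mul, Complex.conj_ofReal, Complex.conj_I, Int.cast_neg]
  have : conj (m : ℂ) = (m : ℂ) := by
    rw [show (m : ℂ) = ((m : ℝ) : ℂ) by norm_cast, Complex.conj_ofReal]
  rw [this]; ring

/-- `(z · y^n).re = z.re · y^n` for real `y`. [folklore] -/
theorem re_mul_pow_ofReal (z : ℂ) (y : ℝ) (n : ℕ) : (z * ((y : ℝ) : ℂ) ^ n).re = z.re * y ^ n := by
  rw [← ofReal_pow, Complex.mul_re, ofReal_re, ofReal_im, mul_zero, sub_zero]

/-- **The integrand identity**: the combination of kernel integrands behind the discrete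
Cauchy–Riemann equations is `Re(e^{-ikt} y^s · bracket) = 0`. [folklore] -/
theorem slitKerFun_cr (k : ℤ) (s : ℕ) (t : ℝ) :
    slitKerFun (k + 1) (s + 1) t + slitKerFun (-k - 1) (s + 1) t - slitKerFun k s t - slitKerFun (-k - 2) s t = 0 := by
  have e1 : (slitCFun (-k - 1) t).re = (cexp (-(((k : ℂ) + 1) * (t : ℂ) * I)) * conj (slitGHat t)).re := by
    rw [show (-k - 1 : ℤ) = -(k + 1) by ring, slitCFun_neg_int_re]; push_cast; ring_nf
  have e2 : (slitCFun (-k - 2) t).re = (cexp (-(((k : ℂ) + 2) * (t : ℂ) * I)) * conj (slitGHat t)).re := by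
    rw [show (-k - 2 : ℤ) = -(k + 2) by ring, slitCFun_neg_int_re]; push_cast; ring_nf
  have e3 : slitCFun (k + 1) t = cexp (-((k : ℂ) * (t : ℂ) * I)) * cexp (-((t : ℂ) * I)) * slitGHat t := by
    rw [slitCFun, ← Complex.exp_add]; push_cast; ring_nf
  have e4 : cexp (-(((k : ℂ) + 1) * (t : ℂ) * I)) = cexp (-((k : ℂ) * (t : ℂ) * I)) * cexp (-((t : ℂ) * I)) := by
    rw [← Complex.exp_add]; ring_nf
  have e5 : cexp (-(((k : ℂ) + 2) * (t : ℂ) * I)) =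
      cexp (-((k : ℂ) * (t : ℂ) * I)) * cexp (-((t : ℂ) * I)) * cexp (-((t : ℂ) * I)) := by
    rw [← Complex.exp_add, ← Complex.exp_add]; ring_nf
  simp only [slitKerFun]
  rw [e1, e2, ← re_mul_pow_ofReal, ← re_mul_pow_ofReal, ← re_mul_pow_ofReal, ← re_mul_pow_ofReal,
    ← Complex.add_re, ← Complex.sub_re, ← Complex.sub_re, e3, e4, e5]
  have hb := slitGHat_bracket_eq_zero t
  have : cexp (-((k : ℂ) * (t : ℂ) * I)) * cexp (-((t : ℂ) * I)) * slitGHat t * ((chmY t : ℝ) : ℂ) ^ (s + 1) +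
      cexp (-((k : ℂ) * (t : ℂ) * I)) * cexp (-((t : ℂ) * I)) * conj (slitGHat t) * ((chmY t : ℝ) : ℂ) ^ (s + 1) -
      slitCFun k t * ((chmY t : ℝ) : ℂ) ^ s -
      cexp (-((k : ℂ) * (t : ℂ) * I)) * cexp (-((t : ℂ) * I)) * cexp (-((t : ℂ) * I)) * conj (slitGHat t) *
        ((chmY t : ℝ) : ℂ) ^ s =
      cexp (-((k : ℂ) * (t : ℂ) * I)) * ((chmY t : ℝ) : ℂ) ^ s *
        (slitGHat t * (cexp (-((t : ℂ) * I)) * (chmY t : ℂ) - 1) +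
          conj (slitGHat t) * cexp (-((t : ℂ) * I)) * ((chmY t : ℂ) - cexp (-((t : ℂ) * I)))) := by
    rw [slitCFun]; ring
  rw [this, hb, mul_zero, Complex.zero_re]

/-- **The master identity** of the slit-plane kernel (behind the s-holomorphicity of CHI's full-plane
spinor `F_{[ℂ_δ,a]}`): for all `k ∈ ℤ`, `s ∈ ℕ`,
`K(k+1, s+1) + K(-k-1, s+1) = K(k, s) + K(-k-2, s)`.
[cite: ChelkakHonglerIzyurovAnnals2015, Lemma 2.14 (s-holomorphicity of F_{[C_δ,a]}) and Remark 3.1 (3.1)] -/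
theorem slitKernel_cr (k : ℤ) (s : ℕ) :
    slitKernel (k + 1) (s + 1) + slitKernel (-k - 1) (s + 1) = slitKernel k s + slitKernel (-k - 2) s := by
  have hI := intervalIntegrable_slitKerFun
  have h : slitKernel (k + 1) (s + 1) + slitKernel (-k - 1) (s + 1) - slitKernel k s - slitKernel (-k - 2) s = 0 := by
    simp only [slitKernel]
    rw [← mul_add, ← mul_sub, ← mul_sub, ← intervalIntegral.integral_add (hI _ _) (hI _ _),
      ← intervalIntegral.integral_sub ((hI _ _).add (hI _ _)) (hI _ _),
      ← intervalIntegral.integral_sub (((hI _ _).add (hI _ _)).sub (hI _ _)) (hI _ _)]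
    rw [intervalIntegral.integral_congr (g := fun _ => (0 : ℝ)) fun t _ => slitKerFun_cr k s t]
    simp
  linarith

/-- **On the row**: `K(2m+1, 1) + K(-2m-1, 1) = binom(2m, m)/4^m` for `m ∈ ℕ` (the slit value
`K(-2m-2, 0)` vanishes). [folklore] -/
theorem slitKernel_cr_row (m : ℕ) :
    slitKernel (2 * m + 1) 1 + slitKernel (-(2 * m) - 1) 1 = (m.centralBinom : ℝ) / 4 ^ m := by
  have h := slitKernel_cr (2 * m) 0
  rw [zero_add, show (-(2 * (m : ℤ)) - 2 : ℤ) = 2 * (-(m : ℤ) - 1) by ring, slitKernel_two_mul_natCast_zero,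
    slitKernel_two_mul_zero_of_neg (by omega : (-(m : ℤ) - 1) ≤ -1), add_zero] at h
  exact h


/-! ### The second master identity `K(k+1,s) + K(-k-2,s+1) = K(k,s+1) + K(-k-1,s)` -/

/-- `(y - e^{-it})² + (e^{-it} y - 1)² = 0` is the identity `y = ½ cos t (1 + y²)` in disguise. [folklore] -/
theorem chmY_sq_identity (t : ℝ) :
    ((chmY t : ℂ) - cexp (-((t : ℂ) * I))) ^ 2 + (cexp (-((t : ℂ) * I)) * (chmY t : ℂ) - 1) ^ 2 = 0 := by
  have hy : (chmY t : ℂ) = 1 / 2 * (Real.cos t : ℂ) * (1 + (chmY t : ℂ) ^ 2) := by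
    have h := congrArg (fun x : ℝ => (x : ℂ)) (chmY_eq_half_cos_mul t)
    push_cast at h
    rw [ofReal_cos]
    exact h
  have hcos : (Real.cos t : ℂ) = (cexp ((t : ℂ) * I) + cexp (-((t : ℂ) * I))) / 2 := by
    rw [ofReal_cos, Complex.cos, show -((t : ℂ) * I) = -(t : ℂ) * I by ring]
  have hee : cexp (-((t : ℂ) * I)) * cexp ((t : ℂ) * I) = 1 := by
    rw [← Complex.exp_add, neg_add_cancel, Complex.exp_zero]
  have hy4 : 4 * (chmY t : ℂ) = (cexp ((t : ℂ) * I) + cexp (-((t : ℂ) * I))) * (1 + (chmY t : ℂ) ^ 2) := by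
    rw [hcos] at hy; linear_combination 4 * hy
  linear_combination (-(1 + (chmY t : ℂ) ^ 2)) * hee + (-cexp (-((t : ℂ) * I))) * hy4

/-- **The second bracket vanishes**: `ĝ (e^{-it} - y) + conj(ĝ) e^{-it} (e^{-it} y - 1) = 0`. [folklore] -/
theorem slitGHat_bracket2_eq_zero (t : ℝ) :
    slitGHat t * (cexp (-((t : ℂ) * I)) - (chmY t : ℂ)) +
      conj (slitGHat t) * cexp (-((t : ℂ) * I)) * (cexp (-((t : ℂ) * I)) * (chmY t : ℂ) - 1) = 0 := by
  by_cases hs : Real.sin t = 0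
  · have hB : circBase 1 (2 * t) = 0 := by
      rw [← norm_eq_zero, norm_circBase_one_two_mul, hs, abs_zero, mul_zero]
    have hg : slitGHat t = 0 := by rw [slitGHat, hB, zero_cpow (by norm_num)]
    rw [hg, map_zero, zero_mul, zero_mul, zero_mul, add_zero]
  · -- `y - e^{-it} ≠ 0` (its imaginary part is `sin t`)
    have hne : (chmY t : ℂ) - cexp (-((t : ℂ) * I)) ≠ 0 := by
      intro h
      have := congrArg Complex.im h
      rw [Complex.sub_im, ofReal_im, cexp_neg_ofReal_mul_I, Complex.sub_im, ofReal_im, Complex.mul_im, ofReal_re,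
        ofReal_im, Complex.I_re, Complex.I_im] at this
      simp at this
      exact hs this
    have h1 := slitGHat_bracket_eq_zero t
    have h2 := chmY_sq_identity t
    -- multiply the claim by `y - e^{-it}` and use `h1`, `h2`
    apply mul_right_cancel₀ hne
    rw [zero_mul]
    linear_combination (cexp (-((t : ℂ) * I)) * (chmY t : ℂ) - 1) * h1 - slitGHat t * h2

/-- **The second integrand identity.** [folklore] -/
theorem slitKerFun_cr' (k : ℤ) (s : ℕ) (t : ℝ) :
    slitKerFun (k + 1) s t + slitKerFun (-k - 2) (s + 1) t - slitKerFun k (s + 1) t - slitKerFun (-k - 1) s t = 0 := by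
  have e1 : (slitCFun (-k - 1) t).re = (cexp (-(((k : ℂ) + 1) * (t : ℂ) * I)) * conj (slitGHat t)).re := by
    rw [show (-k - 1 : ℤ) = -(k + 1) by ring, slitCFun_neg_int_re]; push_cast; ring_nf
  have e2 : (slitCFun (-k - 2) t).re = (cexp (-(((k : ℂ) + 2) * (t : ℂ) * I)) * conj (slitGHat t)).re := by
    rw [show (-k - 2 : ℤ) = -(k + 2) by ring, slitCFun_neg_int_re]; push_cast; ring_nf
  have e3 : slitCFun (k + 1) t = cexp (-((k : ℂ) * (t : ℂ) * I)) * cexp (-((t : ℂ) * I)) * slitGHat t := by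
    rw [slitCFun, ← Complex.exp_add]; push_cast; ring_nf
  have e4 : cexp (-(((k : ℂ) + 1) * (t : ℂ) * I)) = cexp (-((k : ℂ) * (t : ℂ) * I)) * cexp (-((t : ℂ) * I)) := by
    rw [← Complex.exp_add]; ring_nf
  have e5 : cexp (-(((k : ℂ) + 2) * (t : ℂ) * I)) =
      cexp (-((k : ℂ) * (t : ℂ) * I)) * cexp (-((t : ℂ) * I)) * cexp (-((t : ℂ) * I)) := by
    rw [← Complex.exp_add, ← Complex.exp_add]; ring_nf
  simp only [slitKerFun]
  rw [e1, e2, ← re_mul_pow_ofReal, ← re_mul_pow_ofReal, ← re_mul_pow_ofReal, ← re_mul_pow_ofReal,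
    ← Complex.add_re, ← Complex.sub_re, ← Complex.sub_re, e3, e4, e5]
  have hb := slitGHat_bracket2_eq_zero t
  have : cexp (-((k : ℂ) * (t : ℂ) * I)) * cexp (-((t : ℂ) * I)) * slitGHat t * ((chmY t : ℝ) : ℂ) ^ s +
      cexp (-((k : ℂ) * (t : ℂ) * I)) * cexp (-((t : ℂ) * I)) * cexp (-((t : ℂ) * I)) * conj (slitGHat t) *
        ((chmY t : ℝ) : ℂ) ^ (s + 1) -
      slitCFun k t * ((chmY t : ℝ) : ℂ) ^ (s + 1) -
      cexp (-((k : ℂ) * (t : ℂ) * I)) * cexp (-((t : ℂ) * I)) * conj (slitGHat t) * ((chmY t : ℝ) : ℂ) ^ s =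
      cexp (-((k : ℂ) * (t : ℂ) * I)) * ((chmY t : ℝ) : ℂ) ^ s *
        (slitGHat t * (cexp (-((t : ℂ) * I)) - (chmY t : ℂ)) +
          conj (slitGHat t) * cexp (-((t : ℂ) * I)) * (cexp (-((t : ℂ) * I)) * (chmY t : ℂ) - 1)) := by
    rw [slitCFun]; ring
  rw [this, hb, mul_zero, Complex.zero_re]

/-- **The second master identity** (the Cauchy–Riemann equations on the squares based at the odd
sublattice): for all `k ∈ ℤ`, `s ∈ ℕ`, `K(k+1, s) + K(-k-2, s+1) = K(k, s+1) + K(-k-1, s)`.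
[cite: ChelkakHonglerIzyurovAnnals2015, Lemma 2.14 (s-holomorphicity of F_{[C_δ,a]}) and Remark 3.1 (3.1)] -/
theorem slitKernel_cr' (k : ℤ) (s : ℕ) :
    slitKernel (k + 1) s + slitKernel (-k - 2) (s + 1) = slitKernel k (s + 1) + slitKernel (-k - 1) s := by
  have hI := intervalIntegrable_slitKerFun
  have h : slitKernel (k + 1) s + slitKernel (-k - 2) (s + 1) - slitKernel k (s + 1) - slitKernel (-k - 1) s = 0 := by
    simp only [slitKernel]
    rw [← mul_add, ← mul_sub, ← mul_sub, ← intervalIntegral.integral_add (hI _ _) (hI _ _),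
      ← intervalIntegral.integral_sub ((hI _ _).add (hI _ _)) (hI _ _),
      ← intervalIntegral.integral_sub (((hI _ _).add (hI _ _)).sub (hI _ _)) (hI _ _)]
    rw [intervalIntegral.integral_congr (g := fun _ => (0 : ℝ)) fun t _ => slitKerFun_cr' k s t]
    simp
  linarith


/-! ### The discrete holomorphic full-plane spinor on the two sublattices

In the coordinates `k = a + b`, `s = a - b` the corners of CHI's type `1` (the sites of `ℤ²`) are the
points with `k + s` even, the corners of type `i` (the plaquettes) those with `k + s` odd; the
discrete Cauchy–Riemann equation (CHI (3.1)) on the unit square based at `(k, s)` reads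
`i [F(k+1, s+1) - F(k, s)] = F(k, s+1) - F(k+1, s)`. The spinor is real on the even class
(`K(k, |s|)`) and imaginary on the odd class (`∓ i K(-k-1, |s|)`, the sign being the sheet); the
cut of the sheet is the odd part of the row `s = 0` with `k ≤ -1` (CHI's `L_a ∋ a + δ/2`), where the
values from above (`slitFup`) and from below (`slitFdn`) are opposite. -/

/-- The upper sheet sign: `+1` for `s ≥ 0`, `-1` for `s < 0`. [folklore] -/
def slitSgnUp (s : ℤ) : ℂ := if 0 ≤ s then 1 else -1

/-- The lower sheet sign: `+1` for `s > 0`, `-1` for `s ≤ 0`. [folklore] -/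
def slitSgnDn (s : ℤ) : ℂ := if 0 < s then 1 else -1

/-- **The full-plane spinor, cut values from above**: `K(k, |s|)` on the even sublattice,
`-i σ⁺(s) K(-k-1, |s|)` on the odd one. [cite: ChelkakHonglerIzyurovAnnals2015, Lemma 2.14 and §3.2.2 ((F-1-as-hm), (3.7))] -/
def slitFup (k s : ℤ) : ℂ :=
  if Even (k + s) then ((slitKernel k s.natAbs : ℝ) : ℂ) else -I * slitSgnUp s * ((slitKernel (-k - 1) s.natAbs : ℝ) : ℂ)

/-- **The full-plane spinor, cut values from below.** [cite: ChelkakHonglerIzyurovAnnals2015, Lemma 2.14 and §3.2.2 ((F-1-as-hm), (3.7))] -/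
def slitFdn (k s : ℤ) : ℂ :=
  if Even (k + s) then ((slitKernel k s.natAbs : ℝ) : ℂ) else -I * slitSgnDn s * ((slitKernel (-k - 1) s.natAbs : ℝ) : ℂ)

/-- The two sheets agree off the cut `{(k, 0) : k odd, k ≤ -1}`. [folklore] -/
theorem slitFup_eq_slitFdn {k s : ℤ} (h : s ≠ 0 ∨ Even k ∨ 1 ≤ k) : slitFup k s = slitFdn k s := by
  unfold slitFup slitFdn slitSgnUp slitSgnDn
  by_cases hp : Even (k + s)
  · rw [if_pos hp, if_pos hp]
  · rw [if_neg hp, if_neg hp]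
    rcases h with hs | hk | hk
    · rcases lt_or_gt_of_ne hs with hs' | hs'
      · rw [if_neg (by omega), if_neg (by omega)]
      · rw [if_pos hs'.le, if_pos hs']
    · by_cases hs0 : s = 0
      · exfalso; apply hp; rw [hs0, add_zero]; exact hk
      · rcases lt_or_gt_of_ne hs0 with hs' | hs'
        · rw [if_neg (by omega), if_neg (by omega)]
        · rw [if_pos hs'.le, if_pos hs']
    · by_cases hs0 : s = 0
      · -- on `R_a` both vanish: `K(-k-1, 0) = 0` for `-k-1 ≤ -2` even
        subst hs0
        rw [add_zero] at hp
        have hodd : Odd k := Int.not_even_iff_odd.1 hp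
        obtain ⟨j, hj⟩ := hodd
        have : slitKernel (-k - 1) (0 : ℤ).natAbs = 0 := by
          rw [show (0 : ℤ).natAbs = 0 from rfl, show -k - 1 = 2 * (-j - 1) by omega]
          exact slitKernel_two_mul_zero_of_neg (by omega)
        rw [this]; simp
      · rcases lt_or_gt_of_ne hs0 with hs' | hs'
        · rw [if_neg (by omega), if_neg (by omega)]
        · rw [if_pos hs'.le, if_pos hs']

/-- **The spinor sign change across the cut**: at an odd `k`, `slitFup k 0 = -slitFdn k 0`
(both vanish for `k ≥ 1`, i.e. on `R_a`). [cite: ChelkakHonglerIzyurovAnnals2015, Lemma 2.14 (monodromy −1 of F_{[C_δ,a]})] -/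
theorem slitFup_row_eq_neg {k : ℤ} (hk : Odd k) : slitFup k 0 = -slitFdn k 0 := by
  have hp : ¬Even (k + 0) := by rw [add_zero]; exact Int.not_even_iff_odd.2 hk
  unfold slitFup slitFdn slitSgnUp slitSgnDn
  rw [if_neg hp, if_neg hp, if_pos le_rfl, if_neg (lt_irrefl 0)]
  ring

/-- **Normalisation at the tip**: `F(a + 3δ/2) = 1`. [cite: ChelkakHonglerIzyurovAnnals2015, Lemma 2.14] -/
theorem slitFup_zero_zero : slitFup 0 0 = 1 := by
  unfold slitFup
  rw [if_pos (by decide)]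
  simp [slitKernel_zero_zero]

/-- **The value at the source**: `F(a + δ/2) = -i` from above (CHI's `-i · hm^{Ξ'_+}_{a+δ/2}(a+δ/2) = -i`,
proof of Lemma 3.5). [cite: ChelkakHonglerIzyurovAnnals2015, proof of Lemma 3.5] -/
theorem slitFup_neg_one_zero : slitFup (-1) 0 = -I := by
  unfold slitFup slitSgnUp
  rw [if_neg (by decide), if_pos le_rfl]
  simp [slitKernel_zero_zero]

/-- The spinor vanishes on the slit `{(k, 0) : k ≤ -2 even}` and on `R_a = {(k, 0) : k ≥ 1 odd}`.
[cite: ChelkakHonglerIzyurovAnnals2015, §3.2.2 (F¹ = 0 on L_a, F^i = 0 on R_a)] -/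
theorem slitFup_row_eq_zero {k : ℤ} (hk : (Even k ∧ k ≤ -2) ∨ (Odd k ∧ 1 ≤ k)) : slitFup k 0 = 0 := by
  unfold slitFup
  rcases hk with ⟨he, hle⟩ | ⟨ho, hge⟩
  · rw [if_pos (by rwa [add_zero])]
    obtain ⟨j, hj⟩ := he
    rw [show (0 : ℤ).natAbs = 0 from rfl, show k = 2 * j by omega, slitKernel_two_mul_zero_of_neg (by omega)]
    simp
  · rw [if_neg (by rw [add_zero]; exact Int.not_even_iff_odd.2 ho)]
    obtain ⟨j, hj⟩ := ho
    rw [show (0 : ℤ).natAbs = 0 from rfl, show -k - 1 = 2 * (-j - 1) by omega,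
      slitKernel_two_mul_zero_of_neg (by omega)]
    simp

/-- **The discrete Cauchy–Riemann equations on the upper half** (all squares based at `s ≥ 0`,
including those resting on the cut, read with the values from above):
`i [F(k+1,s+1) - F(k,s)] = F(k,s+1) - F(k+1,s)`. [cite: ChelkakHonglerIzyurovAnnals2015, Remark 3.1 (3.1) and Lemma 2.14] -/
theorem slitFup_cr (k : ℤ) {s : ℤ} (hs : 0 ≤ s) :
    I * (slitFup (k + 1) (s + 1) - slitFup k s) = slitFup k (s + 1) - slitFup (k + 1) s := by
  obtain ⟨n, rfl⟩ := Int.eq_ofNat_of_zero_le hs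
  have e1 : ((n : ℤ) + 1).natAbs = n + 1 := by
    rw [show ((n : ℤ) + 1) = ((n + 1 : ℕ) : ℤ) by push_cast; ring]; rfl
  have e0 : (n : ℤ).natAbs = n := rfl
  unfold slitFup slitSgnUp
  rw [e1, e0, if_pos (by positivity : (0 : ℤ) ≤ (n : ℤ) + 1), if_pos (by positivity : (0 : ℤ) ≤ (n : ℤ))]
  rcases Int.even_or_odd (k + n) with hp | hp
  · -- even base square: master identity `M1`
    have h2 : Even (k + 1 + ((n : ℤ) + 1)) := by rw [show k + 1 + ((n : ℤ) + 1) = (k + n) + 2 by ring]; exact hp.add even_two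
    have h3 : ¬Even (k + ((n : ℤ) + 1)) := by
      rw [show k + ((n : ℤ) + 1) = (k + n) + 1 by ring]; exact Int.even_add_one.not.2 (not_not.2 hp)
    have h4 : ¬Even (k + 1 + (n : ℤ)) := by
      rw [show k + 1 + (n : ℤ) = (k + n) + 1 by ring]; exact Int.even_add_one.not.2 (not_not.2 hp)
    rw [if_pos h2, if_pos hp, if_neg h3, if_neg h4, show -(k + 1) - 1 = -k - 2 by ring]
    have M := slitKernel_cr k n
    have M' : ((slitKernel (k + 1) (n + 1) : ℝ) : ℂ) + ((slitKernel (-k - 1) (n + 1) : ℝ) : ℂ) =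
        ((slitKernel k n : ℝ) : ℂ) + ((slitKernel (-k - 2) n : ℝ) : ℂ) := by exact_mod_cast M
    linear_combination I * M'
  · -- odd base square: master identity `M2`
    have hp' : ¬Even (k + n) := Int.not_even_iff_odd.2 hp
    have h2 : ¬Even (k + 1 + ((n : ℤ) + 1)) := by
      rw [show k + 1 + ((n : ℤ) + 1) = (k + n) + 2 by ring]
      exact fun h => hp' ((Int.even_sub.2 (iff_of_true h even_two)) |> fun h' => by simpa using h')
    have h3 : Even (k + ((n : ℤ) + 1)) := by
      rw [show k + ((n : ℤ) + 1) = (k + n) + 1 by ring]; exact hp.add_one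
    have h4 : Even (k + 1 + (n : ℤ)) := by
      rw [show k + 1 + (n : ℤ) = (k + n) + 1 by ring]; exact hp.add_one
    rw [if_neg h2, if_neg hp', if_pos h3, if_pos h4, show -(k + 1) - 1 = -k - 2 by ring]
    have M := slitKernel_cr' k n
    have M' : ((slitKernel (k + 1) n : ℝ) : ℂ) + ((slitKernel (-k - 2) (n + 1) : ℝ) : ℂ) =
        ((slitKernel k (n + 1) : ℝ) : ℂ) + ((slitKernel (-k - 1) n : ℝ) : ℂ) := by exact_mod_cast M
    linear_combination M' - (((slitKernel (-k - 2) (n + 1) : ℝ) : ℂ) - ((slitKernel (-k - 1) n : ℝ) : ℂ)) * Complex.I_sq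

/-- **The discrete Cauchy–Riemann equations on the lower half** (all squares based at `s ≤ -1`,
including those hanging from the cut, read with the values from below).
[cite: ChelkakHonglerIzyurovAnnals2015, Remark 3.1 (3.1) and Lemma 2.14] -/
theorem slitFdn_cr (k : ℤ) {s : ℤ} (hs : s ≤ -1) :
    I * (slitFdn (k + 1) (s + 1) - slitFdn k s) = slitFdn k (s + 1) - slitFdn (k + 1) s := by
  obtain ⟨m, hm⟩ : ∃ m : ℕ, s = -((m : ℤ) + 1) := ⟨(-s - 1).toNat, by omega⟩
  subst hm
  have e1 : (-((m : ℤ) + 1) + 1).natAbs = m := by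
    rw [show (-((m : ℤ) + 1) + 1) = -(m : ℤ) by ring, Int.natAbs_neg]; rfl
  have e0 : (-((m : ℤ) + 1)).natAbs = m + 1 := by
    rw [Int.natAbs_neg, show ((m : ℤ) + 1) = ((m + 1 : ℕ) : ℤ) by push_cast; ring]; rfl
  unfold slitFdn slitSgnDn
  rw [e1, e0, if_neg (by omega : ¬(0 : ℤ) < -((m : ℤ) + 1) + 1), if_neg (by omega : ¬(0 : ℤ) < -((m : ℤ) + 1))]
  rcases Int.even_or_odd (k + -((m : ℤ) + 1)) with hp | hp
  · -- even base square: `M2` at level `m`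
    have h2 : Even (k + 1 + (-((m : ℤ) + 1) + 1)) := by
      rw [show k + 1 + (-((m : ℤ) + 1) + 1) = (k + -((m : ℤ) + 1)) + 2 by ring]; exact hp.add even_two
    have h3 : ¬Even (k + (-((m : ℤ) + 1) + 1)) := by
      rw [show k + (-((m : ℤ) + 1) + 1) = (k + -((m : ℤ) + 1)) + 1 by ring]
      exact Int.even_add_one.not.2 (not_not.2 hp)
    have h4 : ¬Even (k + 1 + -((m : ℤ) + 1)) := by
      rw [show k + 1 + -((m : ℤ) + 1) = (k + -((m : ℤ) + 1)) + 1 by ring]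
      exact Int.even_add_one.not.2 (not_not.2 hp)
    rw [if_pos h2, if_pos hp, if_neg h3, if_neg h4, show -(k + 1) - 1 = -k - 2 by ring]
    have M := slitKernel_cr' k m
    have M' : ((slitKernel (k + 1) m : ℝ) : ℂ) + ((slitKernel (-k - 2) (m + 1) : ℝ) : ℂ) =
        ((slitKernel k (m + 1) : ℝ) : ℂ) + ((slitKernel (-k - 1) m : ℝ) : ℂ) := by exact_mod_cast M
    linear_combination I * M'
  · -- odd base square: `M1` at level `m`
    have hp' : ¬Even (k + -((m : ℤ) + 1)) := Int.not_even_iff_odd.2 hp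
    have h2 : ¬Even (k + 1 + (-((m : ℤ) + 1) + 1)) := by
      rw [show k + 1 + (-((m : ℤ) + 1) + 1) = (k + -((m : ℤ) + 1)) + 2 by ring]
      exact fun h => hp' ((Int.even_sub.2 (iff_of_true h even_two)) |> fun h' => by simpa using h')
    have h3 : Even (k + (-((m : ℤ) + 1) + 1)) := by
      rw [show k + (-((m : ℤ) + 1) + 1) = (k + -((m : ℤ) + 1)) + 1 by ring]; exact hp.add_one
    have h4 : Even (k + 1 + -((m : ℤ) + 1)) := by
      rw [show k + 1 + -((m : ℤ) + 1) = (k + -((m : ℤ) + 1)) + 1 by ring]; exact hp.add_one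
    rw [if_neg h2, if_neg hp', if_pos h3, if_pos h4, show -(k + 1) - 1 = -k - 2 by ring]
    have M := slitKernel_cr k m
    have M' : ((slitKernel (k + 1) (m + 1) : ℝ) : ℂ) + ((slitKernel (-k - 1) (m + 1) : ℝ) : ℂ) =
        ((slitKernel k m : ℝ) : ℂ) + ((slitKernel (-k - 2) m : ℝ) : ℂ) := by exact_mod_cast M
    linear_combination M' + (((slitKernel (-k - 2) m : ℝ) : ℂ) - ((slitKernel (-k - 1) (m + 1) : ℝ) : ℂ)) * Complex.I_sq

end Literature.Probability.LatticeModels
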